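import Mathlib.NumberTheory.GaussSum
import Mathlib.NumberTheory.DirichletCharacter.Basic
import Mathlib.NumberTheory.LegendreSymbol.QuadraticChar.Basic
import Literature.NumberTheory.EllipticCurves.AnticyclotomicRankinSelbergPAdicLFunction
import Literature.NumberTheory.EllipticCurves.PAdicHeightsK
import Literature.NumberTheory.EllipticCurves.PAdicLFunction
import Literature.NumberTheory.GaloisRepresentations.HeckeCharacterProofs
import Literature.NumberTheory.GaloisRepresentations.GlobalArtinMapNormProofs
import HarnessLib

/-!
# Disegni 2017, Theorem A restricted to the CYCLOTOMIC LINE through the trivial character of an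
# imaginary quadratic `K`, and Theorem B ÷ Yuan–Zhang–Zhang (1.1.3) at `χ = 𝟙_K`, TYPED IN THE
# AUTOMORPHIC FRAME — predicates only (definitions + unfolding API; no named fact, nothing asserted)

Topic `Literature/NumberTheory/EllipticCurves`, cluster `Disegni2017` (namespace = path). Companion of
`AnticyclotomicRankinSelbergPAdicLFunction.lean` (Hsieh's ANTICYCLOTOMIC `p`-adic Rankin–Selberg
`L`-function in the same frame: idelic Hecke characters of `K`, the complex Rankin–Selberg values
`rankinSelbergEulerProductHecke f χ′ s` of `BDPAnticyclotomicPAdicLFunction.lean`, an abstract field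
isomorphism `ι : ℚ̄_p ≅ ℂ`), and of `Disegni2017/TwistedBranchLeadingTerm.lean` (the cell memo's
Theorem 1 typed on the Mazur–Tate–Teitelbaum branch). Written by the literature seat of the cell
`bsd-addord` (FULL-BSD rank-`≤ 1` programme, row B6 = O7-ord) at the request of the prover seat
`bsd-addord-gz` (HOME `run/shared/lean/pub/bsd-addord/`, STATUS 2026-08-25 l.356 (3); typing sheet
`lit/HFACT-KERNEL-INPUTS.md`): the seat wants the PRINTED inputs of its ≈ 300-line kernel proof of the
named fact `Disegni2017.delbourgoDatum_rankOne_leadingTerms` ("hFact") stated with COMPLEX central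
values — so that the factorisation of Disegni's function on the line through two Mazur–Tate–Teitelbaum
branches is a THEOREM (Birch's formula `twisted_LValue_eq_holds` + Artin formalism + the uniqueness
principle `MemIwasawaRat.eq_C_mul_mul_of_forall_hasSum`) and not part of a reading.

HONEST FRAMING. This file is DEFINITIONS ONLY (statement SHAPES with their printed locators, and
unfolding lemmas): `CycLineInterpolation` (Theorem A on the line), `ArchRatioClause` ((1.1.3) =
Yuan–Zhang–Zhang at `χ = 𝟙_K`), `PAdicRatioClause` (Theorem B at `χ = 𝟙_K`, constant corrected per
the author's errata, read through footnote (11) of those errata), and their conjunction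
`CycLineGrossZagierClauses`. NOTHING is asserted: the named fact that USES these shapes (and which,
because the tree's height data are abstract, must speak about Delbourgo's datum and Disegni's datum
AT ONCE — see §«Vacuity» below) is the prover seat's to state (sheet §4 (B)); net literature debt of
this file: 0.

## The setting (Disegni, Compos. Math. 153 (2017), §1.1–§1.3, at `F = ℚ`)

`E/ℚ` an elliptic curve (model `W`), `σ_E = π_{f_E}` (`fE` its newform), `M = End⁰ E = ℚ`; `K` an
imaginary quadratic field in which `p` SPLITS; `A := E` ITSELF (the frame "(E, 𝟙_K)" of the sheet,
§3 c10). At `v = p` the representation `σ_{E,p}` is assumed NEARLY `p`-ORDINARY in the sense of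
Def. 1.2.2 ("`σ_v` is an infinite-dimensional subrepresentation of the un-normalised principal series
`Ind(|·|_v α_v, β_v)` … either an irreducible principal series or special of the form `St(α_v)`",
arXiv:1510.02114v3 PDF p. 5) with unit character `α_p = α₀ · ε_p`, `α₀` UNRAMIFIED with `α₀(p) = α`
and `ε = (p*/·)` the quadratic character of conductor `p` (footnote (9), PDF p. 8: "a `p`-partial
version of the notion of `A_{F_v}` acquiring ordinary (good or semistable) reduction over a finite
extension of `F_v`"). This is the case of the cell's rows: `E = V ⊗ ε` with `V` good ORDINARY at `p`
(`α` = unit root) or MULTIPLICATIVE at `p` (`α = a_p(V) = ±1`) — `E` is then ADDITIVE at `p`,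
potentially good ordinary of defect `2` or potentially multiplicative; `σ_{E,K} ⊗ (θ∘N) =
σ_{V,K} ⊗ (εθ)∘N`, so this frame and the memo's "(V, ε_K)" frame describe ONE function (sheet c10).
The datum `(V, α)` enters the predicates below only through the number `α ∈ ℚ_p^×`; the relation
`C • V^{(p*)} = W` is for the consumer's named fact.

## Theorem A on the line (what `CycLineInterpolation` transcribes), with the dictionary

PRINT (PDF pp. 7–8, with the erratum of Disegni, JIMJ 22 (2023) App. B, arXiv:1907.13040v4 PDF p. 31:
"It should be `L_{p,α}(σ_E) ∈ 𝒪(𝒴′)^b` (with the interpolation property being correct for the choice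
of additive character `ψ_p` as in Theorem A)"): a bounded analytic function `L_{p,α}(σ_E)` on the
rigid space `𝒴′` of continuous characters `χ′` of `Γ = E^×_{𝔸^∞}/\overline{E^×V^p}` with
`ω·χ′|_{Ô^{p,×}_F} = 1` (PDF p. 6), characterised by: for every finite-order `χ′ ∈ 𝒴′^{l.c.}`,
`L_{p,α}(σ_E)(χ′) = ∏_{v∣p} Z°_v(χ′_v) · π^{2[F:ℚ]}|D_F|^{1/2} L(1/2, σ_E^ι ⊗ χ′)/(2L(1,η)L(1,σ^ι,ad))`
in `ℂ`, `Z°_v(χ′_v) := ζ_{F,v}(2)L(1,η_v)²/L(1/2,σ_{E,v} ⊗ χ′_v) · ∏_{w∣v} Z_w(χ′_w)`, and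
`Z_w(χ′_w) = τ(χ′_w·α_v∘q, ψ_{E_w})` when `χ′_w·α_v∘q_w` is RAMIFIED, where "for any character `χ̃′_w`
of `E_w^×` of conductor `𝔣`, `τ(χ̃′_w, ψ_{E_w}) := ∫_{w(t) = −w(𝔣)} χ̃′_w(t) ψ_{E,w}(t) dt` with `dt` the
additive Haar measure on `E_w` giving `vol(O_{E_w}, dt) = 1`" (PDF p. 8).
RESTRICTION / DICTIONARY (every item is a specialisation, a definitional unfolding, or a convention
of the tree; sheet §3):
* (c2) THE LINE: `θ_K := (HeckeCharacter.ofDirichlet θ).compRelNorm K` ("`θ ∘ N_{K/ℚ}`",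
  `baseChangeDirichlet`) for `θ` a Dirichlet character of `p`-power conductor; `θ_K` is unramified away
  from `p`, so `θ_K ∈ 𝒴′^{l.c.}(V^p)` for every tame level. Typed range: `θ` mod `p^{m+1}`, EVEN, of
  `p`-POWER ORDER, and PRIMITIVE unless `m = 0` (then `θ = 𝟙` automatically) — i.e. exactly the
  characters of `Γ_ℚ ⊃ 1 + pℤ_p` that the tree's Mazur–Tate–Teitelbaum interpolation and uniqueness
  theorems quantify over (`hasSum_coeff_padicLFunctionBranch_mul_pow_of_isNewformOf`,
  `MemIwasawaRat.eq_of_forall_hasSum`), plus the point `θ = 𝟙` itself.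
* (c1) COMPLEX VALUES: Disegni's `L(s, σ_E ⊗ χ′)` (Euler product over the finite places of `K`,
  unitary normalisation, `χ′_w(ϖ_w)` = the idelic character at the uniformiser idele) is the tree's
  `rankinSelbergEulerProductHecke fE χ′ (s + 1/2)` for the SAME idelic `χ′` (same convention as the
  companion file's "`L(½, π_K ⊗ χ) = rankinSelbergValueHecke f χ 1`"); the typed clauses quantify over
  every ENTIRE CONTINUATION `Λ` of that Euler product from `re s > 2` (the half-plane where the two
  twisted Dirichlet series of sheet §4 (D) converge absolutely term by term; so the clauses are statements
  about the continued value `Λ 1`, resp. `deriv Λ 1`; the continuation exists by Artin formalism +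
  `exists_differentiable_eq_twistedLSeries_holds` and is unique by the identity theorem).
* (c3) `p` SPLIT: two places `w, w̄`, `E_w = ℚ_p`, `f_w = 1`, `v(D) = 0`, `q_w = id`, `η_p = 𝟙`, hence
  `ζ_{ℚ_p}(2)L(1,η_p)² = (1 − p⁻²)⁻¹(1 − p⁻¹)⁻² =: u` (`splitLocalConstant`).
* (c4) THE LOCAL FACTOR on the line: by the DEFINITION of `HeckeCharacter.ofDirichlet`
  ("`ψ_χ(x) = χ(u(x) mod m)⁻¹`", `GaloisRepresentations/HeckeCharacterProofs.lean`) the component of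
  `θ_K` at `w ∣ p` is `u ↦ θ(u)⁻¹` on units and `1` at the idele `p`; so `χ̃ := (θ_K)_w · α_p` is
  `p^k u ↦ α^k (θ⁻¹ε)(u)`, RAMIFIED of conductor `p^{m+1}` at every point of the typed range
  (`θ⁻¹ε` has conductor `p^{m+1}`: `θ` primitive of conductor `≥ p²`, or `m = 0` and `θ⁻¹ε = ε`), and
  the printed integral is `τ(χ̃, ψ⁰) = α^{−(m+1)} Σ_{a ∈ (ℤ/p^{m+1})^×} (θ⁻¹ε)(a) ψ⁰(a/p^{m+1})` (each
  coset `a p^{−(m+1)} + ℤ_p` has `dt`-volume `1`); with the level-`0` character `ψ⁰(x) = e^{2πi{x}_p}`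
  this is `α^{−(m+1)} · gaussSum (θ⁻¹·ε) stdAddChar` (Mathlib). Both characters of the principal
  series / special representation become ramified after the twist, so `L(1/2, σ_{E,p} ⊗ (θ_K)_p) = 1`
  and `Z°_p(θ_K) = u · α^{−2(m+1)} · gaussSum(θ⁻¹ε)²`. CHOICE recorded: `ψ⁰ = stdAddChar`; the other
  level-`0` characters `a.ψ⁰` (`a ∈ ℤ_p^×`, PDF p. 7) multiply `Z°_p` by `(θ⁻¹ε)(a)⁻²` and the function
  by the matching character of `a` ("we have … used the canonical isomorphism `𝒪_{Ψ_p}(ω_p⁻¹) ⊗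
  𝒪_{Ψ_p}(ω_p) = M`", PDF p. 9) — immaterial to the ratio statements below and to every consumer.
* (c5) THE `p`-ADIC POINT: the tree reads `p`-adic avatars in the GEOMETRIC normalisation
  (`IsPAdicAvatarOf`, companion file (S7)); the avatar of `ψ_θ = ofDirichlet θ` is `ι⁻¹ ∘ θ_Gal⁻¹`
  (`ψ_θ(ϖ_ℓ) = θ(ℓ)` while `θ_Gal(Frob_ℓ^{geom}) = θ(ℓ)⁻¹`), so its value at `σ_γ` (`ζ ↦ ζ^γ`,
  `γ = cyclotomicGenerator p`) is `ι⁻¹(θ(γ))⁻¹`, and the restriction `G` of `L_{p,α}(σ_{E,K})` to the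
  line, in the coordinate `T ↔ σ_γ − 1` of the tree's cyclotomic power series, is READ AT
  `T = ι⁻¹(θ(γ))⁻¹ − 1` when it interpolates `L(σ_{E,K} ⊗ θ_K)` (`cycLinePoint`). Sheet §3 c5 checks
  that this is exactly the point at which the MTT branch of `V` carries the same complex `L`-value.
* (c8) THE ARCHIMEDEAN CONSTANT `π²/(2L(1,η)L(1,σ_E,ad))` (`[F:ℚ] = 1`, `|D_F| = 1`) is a POSITIVE REAL
  number depending on `(E, K)` only; it is carried as a parameter `Car` shared with the (1.1.3) clause
  and is existentially quantified (with `0 < Car`) in `CycLineGrossZagierClauses`; `α` never crosses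
  `ι` (the value is written `α^{−2(m+1)} · ι⁻¹(complex part)`, equal to `ι⁻¹` of the printed display
  with `ι(α)` because `ι⁻¹` is a ring isomorphism).
* RECEPTACLE (Lemma 10.2.1/10.2.2, PDF p. 68: bounded = `𝒪_L⟦X⟧ ⊗ L` on each polydisc after a FINITE
  extension of `L`; the line is a one-dimensional sub-disc of the component of `𝒴′` through `𝟙_K`):
  `G : PowerSeries ℂ_p` with BOUNDED coefficients, all lying in ONE finite-dimensional `ℚ_p`-subfield
  of `ℂ_p` (`IsLineFunction`).

## Theorem B ÷ (1.1.3) at `χ = 𝟙_K` (what `ArchRatioClause ∧ PAdicRatioClause` transcribe)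

PRINT: (1.1.3) (PDF pp. 4–5, Yuan–Zhang–Zhang as quoted by Disegni) — for every bilinear pairing on
`A(χ) ⊗ A^∨(χ⁻¹)` there is `𝓛` with `⟨P(f₁,χ), P^∨(f₂,χ⁻¹)⟩ = 𝓛 · Q(f₁,f₂,χ)` for all `f₁, f₂`
(Tunnell–Saito), `Q` "defined over `M` and independent of choices", a generator (so `Q(f₁,f₂,χ) ≠ 0`
for some `f₁,f₂`); for the Néron–Tate pairing `𝓛 = (c_E/2) · π²L′(1/2, σ_{A,E} ⊗ χ)/(2L(1,η)L(1,σ_A,ad))`,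
`c_E ∈ ℚ^×` ((1.1.4)). THEOREM B (PDF p. 9; hypotheses: `A/F_v` potentially `p`-ordinary good or
semistable at `v ∣ p` ✓, `E_v/F_v` split ✓, `ε(A_E,χ) = −1`, `χ` not exceptional — automatic here,
`Z_w(𝟙_w) = α⁻¹τ(ε) ≠ 0`, sheet c4): for the `p`-adic height pairing (1.3.2),
`⟨P(f₁,χ),P^∨(f₂,χ⁻¹)⟩ = c_E · ∏_{v∣p}Z°_v(χ_v)⁻¹ · d_F L_{p,α}(σ_{A,E})(χ) · Q(f₁,f₂,χ)` in
`𝒩*_{𝒴/𝒴′}|_χ ≅ Γ_F ⊗̂ L(χ)` — constant `c_E` as CORRECTED (JIMJ 2023 App. B: "The constant factor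
should be `c_E` and not `c_E/2` (the latter is, according to (1.1.3), the constant factor of the
Gross–Zagier formula in archimedean coefficients)"), and with the conversion of `d_F` into the
derivative along the line PRINTED in footnote (11) there: "the direct analogue of `s ↦ L(1/2+s, σ_E,
χ)` is `χ_F ↦ L_p(σ_E)(χ·χ_F∘N_{E/F})`, whose derivative at `χ_F = 1` is twice our `d_F L_p(σ_E)(χ)`,
as the tangent map to `χ_F ↦ χ′ = χ·χ_F∘N_{E/F} ↦ ω⁻¹·χ′|_{𝔸^×}` is multiplication by `2`". Pairing
the conormal value with the ramified logarithm `ℓ = log_p ∘ χ_cyc : Γ_ℚ → ℚ_p` (Rem. 1.3.1) and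
writing `D := d/ds|_{s=0} G(point of ⟨χ_cyc⟩^s) = ± log_p(γ)·[T¹]G` (sign = geometric/arithmetic
identification `Γ_ℚ ≅ Gal`, (c5)): `⟨d_F L_{p,α}(𝟙_K), ℓ⟩ = ½ D`.
TYPED (the RATIO form; `f₁, f₂, Q, c_E` eliminated): there are `P₁, P₂ ∈ E(K)` (integer multiples of
`P(f₁,𝟙), P^∨(f₂,𝟙) ∈ A(𝟙) = E(K) ⊗ ℚ` for a pair with `Q(f₁,f₂,𝟙) ≠ 0`; both identities are bilinear,
so clearing denominators rescales `q`) and `q ∈ ℚ^×` (`= n₁n₂·c_E·Q(f₁,f₂,𝟙)`) with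
  `⟨P₁,P₂⟩_NT^{abs} = (q/2) · Car · L′`  and  `⟨P₁,P₂⟩_{p,ℓ} = σ₀ · q · Z°_p(𝟙_K)⁻¹ · ½ · log_p(γ) · [T¹]G`,
`σ₀ ∈ {1, −1}` a universal sign (made explicit because the datum below is abstract), `L′ = deriv Λ 1`
for the continuation `Λ` of `rankinSelbergEulerProductHecke fE 𝟙_K` (= `L(E/K, s)`, so `L′ =
LDerivEK W K`, by sheet §4 (D)/§5 K-5 — a theorem for the consumer, not used here), and
`Z°_p(𝟙_K) = u · α⁻² · τ(ε)² = u · p*/α²` (`τ(ε)² = ε(−1)p`; `zCircOne`).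
HEIGHT NORMALISATIONS (sheet c7): Yuan–Zhang–Zhang §7.1.1 ("Our normalization of heights depends on
`F` … `h(x) := [K:F]⁻¹ Σ_w …`") — the Néron–Tate pairing of (1.1.3) on points of `E(K)` is the
ABSOLUTE one over `F = ℚ`, i.e. HALF the `K`-normalised pairing; the tree's `heightPairing` on
`(W.baseChange K)`-points is `K`-normalised ("canonical height on `E` over `K` … twice the height over
`ℚ`", `HeegnerPoints.lean`), whence the `½` in `ArchRatioClause`. Disegni's pairing (1.3.2) at
`χ = 𝟙_K` lives on `A(𝟙) = E(K) ⊗ L` and is ABSOLUTELY normalised ((4.1.7): `ℓ_w := [F′:F]⁻¹ ℓ_v ∘ N`),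
so as a `K`-datum `DhK : PAdicHeightDataK W p K` it restricts to `E(ℚ)` with factor `1`
(`DhK.RestrictsToWith Dh 1`), which is how a consumer ties it to a `ℚ`-datum.

## Vacuity (why no named fact is stated HERE)

`PAdicHeightDataK` is an abstract symmetric bilinear pairing: "∃ `DhK`, `PAdicRatioClause … DhK …`" is
satisfiable by rescaling any datum, so the `p`-adic clause has arithmetic content only TOGETHER with
a second clause about the SAME datum — in the cell: Delbourgo 2002 Thm. (B) for its restriction to
`E(ℚ)` (`Delbourgo2002.LeadingTermClauses`, which pins the regulator up to `ℤ_p^×`), the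
identification "Disegni's (1.3.2) restricted to `E(ℚ)` = Nekovář's height of `V_pE` with its
canonical potentially-ordinary splitting = `½`·Schneider over `ℚ(√p*)` = Delbourgo's `⟨,⟩_{p,ℚ}`"
being the referee condition GZ-H (Rem. 1.3.2 + (4.1.7)–(4.1.8) + Delbourgo 2002 p. 39), exactly as in
`TwistedBranchLeadingTerm.lean` §«Why a CONJOINED fact». That conjoined statement is the PROVER's
named fact (sheet §4 (B)); this file supplies its Disegni-side conjunct `CycLineGrossZagierClauses`.

## What is NOT here

No Shimura-curve objects (`P(f,χ)`, `Q`, `π_A(𝔹)`), no Nekovář height as an object, no anticyclotomic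
variable, no `p` inert or ramified in `K` ([II]/[III] territory), no general finite-order `χ′` off the
line, no unit character beyond `α₀·ε` (defect `3,4,6` would replace `ε` by a character of order `e`:
`-- TODO(general form)`), nothing at `p = 2`, and NOTHING ASSERTED.

## References

* [Disegni2017] D. Disegni, *The `p`-adic Gross–Zagier formula on Shimura curves*, Compos. Math. 153
  (2017) 1987–2074 = arXiv:1510.02114v3: §1.1 (1.1.1)–(1.1.4) (PDF 4–5), Def. 1.2.2 + fn. (9) (PDF 5,
  8), §1.2 `𝒴′, 𝒴, 𝒴_F`, (1.2.1) (PDF 6), Theorem A with `Z°_v`, `Z_w`, `τ` (PDF 7–8), (1.3.1)–(1.3.2),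
  Rem. 1.3.1/1.3.2, Def. 1.3.3, `𝒩*_{𝒴/𝒴′}`, `d_F`, Theorem B (PDF 8–9), §4.1 (4.1.5)–(4.1.8) (PDF 39),
  Lemma 10.2.1/10.2.2 (PDF 68), Lemma A.1.1 (PDF 70–71).
* [Disegni2023ShimuraII] D. Disegni, *… II: nonsplit primes*, J. Inst. Math. Jussieu 22 (2023) 2199–2240 =
  arXiv:1907.13040v4, Appendix B "Errata to [I]" (PDF 31–32): Theorem A/B corrections and footnote (11).
* [YuanZhangZhang2013] X. Yuan, S.-W. Zhang, W. Zhang, Ann. Math. Stud. 184 (2013), Thm. 1.2, §1.2.4,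
  §7.1.1 (height normalisation).
* [Delbourgo2002] D. Delbourgo, J. Number Theory 95 (2002) p. 39 (`⟨,⟩_{p,ℚ}`), Thm. (B) p. 40.
* Cell: `run/shared/lean/pub/bsd-addord/lit/HFACT-KERNEL-INPUTS.md` (typing sheet, conventions c1–c10),
  `proof/PROOF-gz.md` §3 (the proof these clauses feed), `REF-gz.md` (condition GZ-H).
-/

noncomputable section

open scoped MatrixGroups ModularForm NumberField
open CongruenceSubgroup NumberField IsDedekindDomain WeierstrassCurve
open Literature.NumberTheory.GaloisRepresentations
open Literature.NumberTheory.EllipticCurves.ModularForms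

namespace Literature.NumberTheory.EllipticCurves.Disegni2017

/-- `p^(m+1) ≠ 0` as an instance (levels of the characters on the line; plumbing). [folklore] -/
instance neZero_prime_pow_succ (p : ℕ) [Fact p.Prime] (m : ℕ) : NeZero (p ^ (m + 1)) :=
  ⟨pow_ne_zero _ (Fact.out : p.Prime).ne_zero⟩

/-! ### §1 The line: base change of a Dirichlet character, the quadratic character, constants -/

section Line

variable (K : Type) [Field K] [NumberField K] [IsGalois ℚ K]

/-- **The Hecke character `θ ∘ N_{K/ℚ}` of `K`** attached to a Dirichlet character `θ` mod `n`:
the base change along the norm (`HeckeCharacter.compRelNorm`) of the finite-order Hecke character of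
`ℚ` of `θ` (`HeckeCharacter.ofDirichlet`, normalised `ψ_θ(⟨ϖ_ℓ⟩) = θ(ℓ)` for `ℓ ∤ n`, and on units at
`ℓ ∣ n`: `u ↦ θ(u mod n)⁻¹`). For `θ` of `p`-power conductor these are the finite-order points of the
cyclotomic line `{χ_F ∘ N_{E/F}}` through `𝟙_K` in Disegni's `𝒴′` (the "direct analogue" line of the
errata's footnote (11)). [cite: Disegni2017, §1.2 (𝒴′, 𝒴_F; arXiv v3 PDF p. 6)]
[cite: Disegni2023ShimuraII, App. B fn. (11) (arXiv v4 PDF p. 31)] -/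
def baseChangeDirichlet {n : ℕ} [NeZero n] (θ : DirichletCharacter ℂ n) : HeckeCharacter K :=
  (HeckeCharacter.ofDirichlet θ).compRelNorm K

variable {K}

/-- Unfolding of `baseChangeDirichlet`. [cite: Disegni2017, §1.2 (arXiv v3 PDF p. 6)] -/
theorem baseChangeDirichlet_def {n : ℕ} [NeZero n] (θ : DirichletCharacter ℂ n) :
    baseChangeDirichlet K θ = (HeckeCharacter.ofDirichlet θ).compRelNorm K := rfl

/-- **The trivial Dirichlet character base-changes to the trivial Hecke character of `K`**
(`ψ_𝟙 = 𝟙`, `𝟙 ∘ N = 𝟙`): the point `θ = 𝟙` of the line IS `𝟙_K ∈ 𝒴 ⊂ 𝒴′`, the character at which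
Theorem B is applied. [cite: Disegni2017, §1.2 (1.2.1) (arXiv v3 PDF p. 6)] -/
theorem baseChangeDirichlet_one {n : ℕ} [NeZero n] :
    baseChangeDirichlet K (1 : DirichletCharacter ℂ n) = 1 := by
  refine HeckeCharacter.ext fun y ↦ ?_
  rw [baseChangeDirichlet, HeckeCharacter.compRelNorm_apply, HeckeCharacter.ofDirichlet_apply,
    HeckeCharacter.one_apply, inv_eq_one]
  ext
  rw [MulChar.coe_toUnitHom, MulChar.one_apply_coe, Units.val_one]

variable (p : ℕ) [Fact p.Prime]

/-- **The quadratic character `ε = (·/p)` as a complex Dirichlet character of level `p^n`** (`n ≥ 1`):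
the Legendre character of `ℤ/p` (Mathlib `quadraticChar (ZMod p)`, values in `ℤ`) pushed to `ℂ` and
raised to level `p^n` (`DirichletCharacter.changeLevel`). It is the restriction to `ℤ_p^×` of the unit
character `α_p = α₀·ε_p` of `σ_{E,p}` for `E = V ⊗ ε` (module docstring (c4)); `τ(ε)² = ε(−1)·p = p*`.
[cite: Disegni2017, Def. 1.2.2 and fn. (9) (arXiv v3 PDF pp. 5, 8)] -/
def legendreLevel (n : ℕ) (hn : n ≠ 0) : DirichletCharacter ℂ (p ^ n) :=
  DirichletCharacter.changeLevel (dvd_pow_self p hn)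
    ((quadraticChar (ZMod p)).ringHomComp (Int.castRingHom ℂ))

/-- **`u := ζ_{ℚ_p}(2) · L(1, η_p)² = (1 − p⁻²)⁻¹ (1 − p⁻¹)⁻²`** — the local constant of `Z°_p` at a
prime `p` SPLIT in `K` (`η_p = 𝟙`; module docstring (c3)); a rational number, never `0`.
[cite: Disegni2017, Theorem A, definition of Z°_v (arXiv v3 PDF p. 7)] -/
def splitLocalConstant : ℚ :=
  ((1 - ((p : ℚ) ^ 2)⁻¹) * (1 - (p : ℚ)⁻¹) ^ 2)⁻¹

/-- `p* = (−1)^{(p−1)/2} · p` (so that `ε = (p*/·)` and `τ(ε)² = p*`: the square of the Gauss sum in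
`Z°_p(𝟙_K) = u·α⁻²·τ(ε)²`). [cite: Disegni2017, Theorem A (Z_w, τ; arXiv v3 PDF p. 8)] -/
def pStar : ℤ := (-1) ^ ((p - 1) / 2) * p

/-- **`Z°_p(𝟙_K) = u · α⁻² · τ(ε)² = u · p*/α²`** — the interpolation factor of Theorem A / Theorem B
at the trivial character of `K` for `σ_{E,p}` nearly ordinary with unit character `α₀·ε_p`
(`Z_w(𝟙_w) = τ(α₀ε_p, ψ⁰) = α⁻¹·τ(ε)` at both `w ∣ p`, `L(1/2, σ_{E,p}) = 1`; module docstring (c4);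
never `0`: `𝟙_K` is NOT exceptional, Def. 1.3.3). A `p`-adic number (`α ∈ ℚ_p^×`).
[cite: Disegni2017, Theorem A (Z°_v, Z_w; arXiv v3 PDF pp. 7–8) and Def. 1.3.3 (PDF p. 9)] -/
def zCircOne (α : ℚ_[p]) : ℚ_[p] :=
  (splitLocalConstant p : ℚ_[p]) * (pStar p : ℚ_[p]) * (α ^ 2)⁻¹

end Line

/-! ### §2 The receptacle and the evaluation points on the line -/

section Receptacle

variable {p : ℕ} [Fact p.Prime]

/-- **A bounded function on the line**: `G ∈ ℂ_p⟦T⟧` with BOUNDED coefficients all lying in ONE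
finite-dimensional `ℚ_p`-subfield of `ℂ_p` — the restriction to a one-dimensional sub-disc of a bounded
section over a finite extension `L/ℚ_p` ("`𝒪(D_n)^b = O_L⟦X_1,…,X_n⟧ ⊗ L`", Lemma 10.2.1; Lemma 10.2.2:
"after base-change to a finite extension of `L`, there is an isomorphism `𝒴 → ∐ D^{(i)}`"). The second
conjunct lets a consumer run the Weierstrass-preparation uniqueness argument over a discretely valued
field (sheet Q1). [cite: Disegni2017, Lemma 10.2.1 and 10.2.2 (arXiv v3 PDF p. 68); Theorem A «∈ 𝒪(𝒴′)^b» as corrected]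
[cite: Disegni2023ShimuraII, App. B, Theorem A (arXiv v4 PDF p. 31)] -/
def IsLineFunction (G : PowerSeries ℂ_[p]) : Prop :=
  (∃ C : ℝ, ∀ k : ℕ, ‖PowerSeries.coeff k G‖ ≤ C) ∧
    ∃ L : IntermediateField ℚ_[p] ℂ_[p], FiniteDimensional ℚ_[p] L ∧ ∀ k : ℕ, PowerSeries.coeff k G ∈ L

/-- **The value of `G ∈ ℂ_p⟦T⟧` at a point `x` of the open unit disc**: `Σ_k [T^k]G · x^k = v`
(a `HasSum` in `ℂ_p`; same currency as `IntSeries.HasValueAt` / `UnrSeries.HasValueAt` of the companion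
files and as the evaluation sums of `MemIwasawaRat.eq_of_forall_hasSum`).
[cite: Disegni2017, Theorem A (arXiv v3 PDF p. 7)] -/
def HasLineValueAt (G : PowerSeries ℂ_[p]) (x v : ℂ_[p]) : Prop :=
  HasSum (fun k : ℕ ↦ PowerSeries.coeff k G * x ^ k) v

/-- The value at a point is unique. [cite: Disegni2017, Theorem A (arXiv v3 PDF p. 7)] -/
theorem HasLineValueAt.unique {G : PowerSeries ℂ_[p]} {x v v' : ℂ_[p]} (h : HasLineValueAt G x v)
    (h' : HasLineValueAt G x v') : v = v' :=
  HasSum.unique h h'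

/-- The value at `T = 0` is the constant coefficient (evaluation of Theorem A's function at the
trivial character). [cite: Disegni2017, Theorem A (arXiv v3 PDF p. 7)] -/
theorem hasLineValueAt_zero (G : PowerSeries ℂ_[p]) :
    HasLineValueAt G 0 (PowerSeries.constantCoeff G) := by
  have h : HasSum (fun k : ℕ ↦ PowerSeries.coeff k G * (0 : ℂ_[p]) ^ k)
      (PowerSeries.coeff 0 G * (0 : ℂ_[p]) ^ 0) :=
    hasSum_single 0 fun k hk ↦ by simp [hk]
  simpa [HasLineValueAt] using h

/-- If `G` has value `v` at `0` then `v = [T⁰]G` (Theorem A at the trivial character reads the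
constant coefficient). [cite: Disegni2017, Theorem A (arXiv v3 PDF p. 7)] -/
theorem HasLineValueAt.eq_constantCoeff {G : PowerSeries ℂ_[p]} {v : ℂ_[p]}
    (h : HasLineValueAt G 0 v) : v = PowerSeries.constantCoeff G :=
  h.unique (hasLineValueAt_zero G)

variable (ι : PadicAlgCl p ≃+* ℂ)

/-- **The point of the line attached to a Dirichlet character `θ` mod `p^{m+1}`**:
`T = ι⁻¹(θ(γ))⁻¹ − 1`, `γ = cyclotomicGenerator p` — the value at `σ_γ` (`ζ ↦ ζ^γ`) of the GEOMETRICALLY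
normalised `p`-adic avatar `ι⁻¹ ∘ θ_Gal⁻¹` of `ψ_θ = ofDirichlet θ`, minus `1` (module docstring (c5);
for `θ = 𝟙` this is `0`). [cite: Disegni2017, Theorem A (arXiv v3 PDF p. 7); §1.2 (PDF p. 6)] -/
def cycLinePoint {m : ℕ} (θ : DirichletCharacter ℂ (p ^ (m + 1))) : ℂ_[p] :=
  (((ι.symm (θ (cyclotomicGenerator p : ZMod (p ^ (m + 1)))) : PadicAlgCl p) : ℂ_[p]))⁻¹ - 1

/-- The point of the trivial character is `T = 0`. [cite: Disegni2017, §1.2 (arXiv v3 PDF p. 6)] -/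
theorem cycLinePoint_one (m : ℕ) :
    cycLinePoint ι (1 : DirichletCharacter ℂ (p ^ (m + 1))) = 0 := by
  have hp : p.Prime := Fact.out
  have he : cyclotomicExponent p ≠ 0 := by
    unfold cyclotomicExponent; split_ifs <;> omega
  have hcop : Nat.Coprime (cyclotomicGenerator p) (p ^ (m + 1)) := by
    refine Nat.Coprime.pow_right _ ?_
    rw [cyclotomicGenerator, Nat.coprime_comm, hp.coprime_iff_not_dvd, add_comm]
    intro h
    have h1 : p ∣ 1 := (Nat.dvd_add_right (dvd_pow_self p he)).mp h
    exact hp.one_lt.ne' (Nat.dvd_one.mp h1)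
  have hu : IsUnit ((cyclotomicGenerator p : ℕ) : ZMod (p ^ (m + 1))) :=
    (ZMod.isUnit_iff_coprime _ _).mpr hcop
  simp [cycLinePoint, MulChar.one_apply hu, PadicComplex.coe_eq]

end Receptacle

/-! ### §3 Theorem A on the line: the interpolation predicate -/

section Interpolation

variable {p : ℕ} [Fact p.Prime] (ι : PadicAlgCl p ≃+* ℂ)
  (K : Type) [Field K] [NumberField K] [IsGalois ℚ K] {N : ℕ}

/-- **The complex part of Disegni's interpolation value on the line** at the character `θ` mod
`p^{m+1}`: `u · gaussSum(θ⁻¹·ε)² · Car · L₁` — `u = splitLocalConstant p`, the squared Gauss sum =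
`α^{2(m+1)}·Z_w Z_{w̄}` (module docstring (c4)), `Car` the archimedean constant
`π²/(2L(1,η)L(1,σ_E,ad))` carried as a parameter (c8), and `L₁` standing for the continued central value
`L(1/2, σ_{E,K} ⊗ θ_K) = Λ 1` (c1). The `p`-adic unit-root power `α^{−2(m+1)}` is kept OUTSIDE `ι⁻¹`
(`cycLineValue`). [cite: Disegni2017, Theorem A with Z°_v, Z_w, τ (arXiv v3 PDF pp. 7–8)] -/
def cycLineComplexPart {m : ℕ} (θ : DirichletCharacter ℂ (p ^ (m + 1))) (Car : ℝ) (L₁ : ℂ) : ℂ :=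
  (splitLocalConstant p : ℂ) * gaussSum (θ⁻¹ * legendreLevel p (m + 1) (Nat.succ_ne_zero m))
      (ZMod.stdAddChar (N := p ^ (m + 1))) ^ 2 * (Car : ℂ) * L₁

/-- **Disegni's interpolation value on the line, as an element of `ℂ_p`**:
`α^{−2(m+1)} · ι⁻¹(u · gaussSum(θ⁻¹ε)² · Car · L₁)` — Theorem A's `∏_{v∣p}Z°_v(χ′_v)·π²L(1/2,σ_E⊗χ′)/
(2L(1,η)L(1,σ,ad))` at `χ′ = θ_K`, `F = ℚ`, `p` split, unit character `α₀ε_p` (module docstring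
(c1)–(c4), (c8)). [cite: Disegni2017, Theorem A (arXiv v3 PDF pp. 7–8)] -/
def cycLineValue (α : ℚ_[p]) {m : ℕ} (θ : DirichletCharacter ℂ (p ^ (m + 1))) (Car : ℝ) (L₁ : ℂ) :
    ℂ_[p] :=
  algebraMap ℚ_[p] ℂ_[p] ((α⁻¹) ^ (2 * (m + 1))) *
    ((ι.symm (cycLineComplexPart (p := p) θ Car L₁) : PadicAlgCl p) : ℂ_[p])

/-- **Theorem A of Disegni 2017 RESTRICTED TO THE CYCLOTOMIC LINE through `𝟙_K`** (characterising
predicate; module docstring §«Theorem A on the line»). `G ∈ ℂ_p⟦T⟧` is a bounded line function and, for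
every `m` and every Dirichlet character `θ` mod `p^{m+1}` which is EVEN, of `p`-POWER ORDER, and
PRIMITIVE unless `m = 0` (the finite-order points of the line lying over characters of
`Γ ≅ 1 + pℤ_p`, together with `θ = 𝟙` at level `p`), and for every ENTIRE CONTINUATION `Λ` of the
Rankin–Selberg Euler product `rankinSelbergEulerProductHecke fE (θ∘N_{K/ℚ}) s` from `re s > 2`:
the value of `G` at `T = ι⁻¹(θ(γ))⁻¹ − 1` is `α^{−2(m+1)} · ι⁻¹(u · gaussSum(θ⁻¹ε)² · Car · Λ(1))`.
Parameters: `ι : ℚ̄_p ≅ ℂ`, the field `K`, the newform `fE` of `σ_E`, the unit-root datum `α ∈ ℚ_p`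
(`α₀(p)`), the archimedean constant `Car`. A PREDICATE (nothing asserted); Theorem A (as corrected)
says: for `K` imaginary quadratic with `p` split and `σ_{E,p}` nearly ordinary with unit character
`α₀·ε_p`, the restriction of `L_{p,α}(σ_{E,K})` to the line satisfies it with
`Car = π²/(2L(1,η_K)L(1,σ_E,ad))`.
[cite: Disegni2017, Theorem A (arXiv v3 PDF pp. 7–8), §1.2 (PDF p. 6), Lemma 10.2.1–10.2.2 (PDF p. 68)]
[cite: Disegni2023ShimuraII, App. B, Theorem A (arXiv v4 PDF p. 31)] -/
def CycLineInterpolation (fE : CuspForm (Gamma0 N) 2) (α : ℚ_[p]) (Car : ℝ)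
    (G : PowerSeries ℂ_[p]) : Prop :=
  IsLineFunction G ∧
    ∀ (m : ℕ) (θ : DirichletCharacter ℂ (p ^ (m + 1))), θ.Even → (∃ j : ℕ, orderOf θ = p ^ j) →
      (θ.IsPrimitive ∨ m = 0) →
      ∀ Λ : ℂ → ℂ, Differentiable ℂ Λ →
        (∀ s : ℂ, 2 < s.re →
          Λ s = rankinSelbergEulerProductHecke fE (baseChangeDirichlet K θ) s) →
        HasLineValueAt G (cycLinePoint ι θ) (cycLineValue ι α θ Car (Λ 1))

variable {ι K}

/-- Unfolding `CycLineInterpolation` at one character of the typed range.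
[cite: Disegni2017, Theorem A (arXiv v3 PDF pp. 7–8)] -/
theorem CycLineInterpolation.hasLineValueAt {fE : CuspForm (Gamma0 N) 2} {α : ℚ_[p]} {Car : ℝ}
    {G : PowerSeries ℂ_[p]} (h : CycLineInterpolation ι K fE α Car G) {m : ℕ}
    {θ : DirichletCharacter ℂ (p ^ (m + 1))} (heven : θ.Even) (hord : ∃ j : ℕ, orderOf θ = p ^ j)
    (hprim : θ.IsPrimitive ∨ m = 0) {Λ : ℂ → ℂ} (hΛ : Differentiable ℂ Λ)
    (hΛ' : ∀ s : ℂ, 2 < s.re →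
      Λ s = rankinSelbergEulerProductHecke fE (baseChangeDirichlet K θ) s) :
    HasLineValueAt G (cycLinePoint ι θ) (cycLineValue ι α θ Car (Λ 1)) :=
  h.2 m θ heven hord hprim Λ hΛ hΛ'

/-- `CycLineInterpolation` records that `G` is a bounded line function.
[cite: Disegni2017, Lemma 10.2.1–10.2.2 (arXiv v3 PDF p. 68)] -/
theorem CycLineInterpolation.isLineFunction {fE : CuspForm (Gamma0 N) 2} {α : ℚ_[p]} {Car : ℝ}
    {G : PowerSeries ℂ_[p]} (h : CycLineInterpolation ι K fE α Car G) : IsLineFunction G :=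
  h.1

/-- **The point `θ = 𝟙`**: the constant coefficient of `G` is `α⁻² · ι⁻¹(u · τ(ε)² · Car · Λ(1))` for
every entire continuation `Λ` of `rankinSelbergEulerProductHecke fE 𝟙_K` — Theorem A at `χ′ = 𝟙_K`
(in analytic rank one of `E/K` this value is `0`: `Λ 1 = L(E/K,1) = 0`, consumer-side).
[cite: Disegni2017, Theorem A (arXiv v3 PDF pp. 7–8)] -/
theorem CycLineInterpolation.constantCoeff_eq {fE : CuspForm (Gamma0 N) 2} {α : ℚ_[p]} {Car : ℝ}
    {G : PowerSeries ℂ_[p]} (h : CycLineInterpolation ι K fE α Car G) {Λ : ℂ → ℂ}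
    (hΛ : Differentiable ℂ Λ)
    (hΛ' : ∀ s : ℂ, 2 < s.re →
      Λ s = rankinSelbergEulerProductHecke fE
        (baseChangeDirichlet K (1 : DirichletCharacter ℂ (p ^ (0 + 1)))) s) :
    PowerSeries.constantCoeff G =
      cycLineValue ι α (1 : DirichletCharacter ℂ (p ^ (0 + 1))) Car (Λ 1) := by
  have heven : (1 : DirichletCharacter ℂ (p ^ (0 + 1))).Even :=
    MulChar.one_apply isUnit_one.neg
  have hv := h.2 0 1 heven ⟨0, by rw [orderOf_one, pow_zero]⟩ (Or.inr rfl) Λ hΛ hΛ'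
  rw [cycLinePoint_one] at hv
  exact (hv.eq_constantCoeff).symm

end Interpolation

/-! ### §4 Theorem B ÷ (1.1.3) at `χ = 𝟙_K`: the two ratio clauses -/

section Ratio

variable {p : ℕ} [Fact p.Prime] (W : WeierstrassCurve ℚ) (K : Type) [Field K] [NumberField K] {N : ℕ}

/-- **(1.1.3) at `χ = 𝟙_K` in ratio form** (Yuan–Zhang–Zhang as quoted by Disegni, with
Tunnell–Saito; module docstring §«Theorem B ÷ (1.1.3)»): for the points `P₁, P₂ ∈ E(K)` and the
rational `q` (`= n₁n₂·c_E·Q(f₁,f₂,𝟙)`), and every entire continuation `Λ` of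
`rankinSelbergEulerProductHecke fE 𝟙_K` (`= L(E/K, ·)`): `½·⟨P₁,P₂⟩_{NT,K} = (q/2) · Car · Λ′(1)` — the
`½` converting the tree's `K`-normalised `heightPairing` into YZZ's absolute one (§7.1.1), the `q/2`
being (1.1.3)'s `c_E/2 · Q`. A PREDICATE.
[cite: Disegni2017, (1.1.3)–(1.1.4) and the Tunnell–Saito paragraph (arXiv v3 PDF pp. 4–5)]
[cite: YuanZhangZhang2013, Thm. 1.2 and §7.1.1] -/
def ArchRatioClause (fE : CuspForm (Gamma0 N) 2) (Car : ℝ)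
    (P₁ P₂ : (W.baseChange K).toAffine.Point) (q : ℚ) : Prop :=
  ∀ Λ : ℂ → ℂ, Differentiable ℂ Λ →
    (∀ s : ℂ, 2 < s.re →
      Λ s = rankinSelbergEulerProductHecke fE (1 : HeckeCharacter K) s) →
    (((P₁.heightPairing P₂ / 2 : ℝ)) : ℂ) = (q : ℂ) / 2 * (Car : ℂ) * deriv Λ 1

/-- **Theorem B at `χ = 𝟙_K` in ratio form** (constant `c_E` as corrected; `d_F` converted by the
errata's footnote (11); module docstring §«Theorem B ÷ (1.1.3)»): for Disegni's `p`-adic height pairing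
(1.3.2) composed with `ℓ = log_p ∘ χ_cyc`, viewed as a `K`-datum `DhK`, the same `P₁, P₂, q` as in
`ArchRatioClause`, and a universal sign `σ₀`:
`⟨P₁,P₂⟩_{p,ℓ} = σ₀ · q · Z°_p(𝟙_K)⁻¹ · ½ · log_p(γ) · [T¹]G` in `ℂ_p`. A PREDICATE; vacuous on its own
for an abstract `DhK` (module docstring §«Vacuity»).
[cite: Disegni2017, Theorem B (arXiv v3 PDF p. 9), Rem. 1.3.1 (ℓ), 𝒩*_{𝒴/𝒴′} and d_F (PDF p. 9)]
[cite: Disegni2023ShimuraII, App. B, Theorem B and fn. (11) (arXiv v4 PDF p. 31)] -/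
def PAdicRatioClause (α : ℚ_[p]) (G : PowerSeries ℂ_[p]) (DhK : PAdicHeightDataK W p K)
    (P₁ P₂ : (W.baseChange K).toAffine.Point) (q : ℚ) (σ₀ : ℤˣ) : Prop :=
  algebraMap ℚ_[p] ℂ_[p] (DhK.pairing P₁ P₂) =
    ((σ₀ : ℤ) : ℂ_[p]) * (q : ℂ_[p]) *
      algebraMap ℚ_[p] ℂ_[p] ((zCircOne p α)⁻¹ * 2⁻¹ * padicLog p (cyclotomicGenerator p)) *
      PowerSeries.coeff 1 G

variable (ι : PadicAlgCl p ≃+* ℂ)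

/-- **Disegni 2017 Thm. A (on the line) ∧ Thm. B ÷ (1.1.3) (at `𝟙_K`) for ONE archimedean constant,
ONE line function and ONE pair of points** — the Disegni-side conjunct of the prover's conjoined named
fact (module docstring §«Vacuity»; sheet §4 (B)): there are `Car > 0` and a line function `G` with
`CycLineInterpolation ι K fE α Car G`, and points `P₁, P₂ ∈ E(K)`, `q ∈ ℚ^×`, `σ₀ = ±1` with
`ArchRatioClause … Car P₁ P₂ q` and `PAdicRatioClause … α G DhK P₁ P₂ q σ₀`. A PREDICATE in the
`K`-height datum `DhK` (print: Disegni's (1.3.2) at `χ = 𝟙_K` composed with `log_p ∘ χ_cyc`, absolutely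
normalised — it restricts to `E(ℚ)` with factor `1`, (4.1.7)). Under Theorem A/B's hypotheses at
`F = ℚ` — `K` imaginary quadratic, every prime of `N_E` split in `K` (so `p` split and
`ε(E/K) = −1`), `σ_{E,p}` nearly ordinary with unit character `α₀·ε_p` — the printed theorems give it.
[cite: Disegni2017, Theorem A (arXiv v3 PDF pp. 7–8), Theorem B (PDF p. 9), (1.1.3) (PDF pp. 4–5), (4.1.7) (PDF p. 39)]
[cite: Disegni2023ShimuraII, App. B (arXiv v4 PDF p. 31)] [cite: YuanZhangZhang2013, Thm. 1.2, §7.1.1] -/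
def CycLineGrossZagierClauses [IsGalois ℚ K] (fE : CuspForm (Gamma0 N) 2) (α : ℚ_[p])
    (DhK : PAdicHeightDataK W p K) : Prop :=
  ∃ Car : ℝ, 0 < Car ∧ ∃ G : PowerSeries ℂ_[p], CycLineInterpolation ι K fE α Car G ∧
    ∃ (P₁ P₂ : (W.baseChange K).toAffine.Point) (q : ℚ) (σ₀ : ℤˣ), q ≠ 0 ∧
      ArchRatioClause W K fE Car P₁ P₂ q ∧ PAdicRatioClause W K α G DhK P₁ P₂ q σ₀

/-! #### API -/

variable {W K ι}

/-- Unfolding `PAdicRatioClause`. [cite: Disegni2017, Theorem B (arXiv v3 PDF p. 9)] -/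
theorem padicRatioClause_iff (α : ℚ_[p]) (G : PowerSeries ℂ_[p]) (DhK : PAdicHeightDataK W p K)
    (P₁ P₂ : (W.baseChange K).toAffine.Point) (q : ℚ) (σ₀ : ℤˣ) :
    PAdicRatioClause W K α G DhK P₁ P₂ q σ₀ ↔
      algebraMap ℚ_[p] ℂ_[p] (DhK.pairing P₁ P₂) =
        ((σ₀ : ℤ) : ℂ_[p]) * (q : ℂ_[p]) *
          algebraMap ℚ_[p] ℂ_[p] ((zCircOne p α)⁻¹ * 2⁻¹ * padicLog p (cyclotomicGenerator p)) *
          PowerSeries.coeff 1 G :=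
  Iff.rfl

/-- The pieces of `CycLineGrossZagierClauses`. [cite: Disegni2017, Theorem A/B (arXiv v3 PDF pp. 7–9)] -/
theorem CycLineGrossZagierClauses.exists_interpolation [IsGalois ℚ K] {fE : CuspForm (Gamma0 N) 2}
    {α : ℚ_[p]} {DhK : PAdicHeightDataK W p K} (h : CycLineGrossZagierClauses W K ι fE α DhK) :
    ∃ Car : ℝ, 0 < Car ∧ ∃ G : PowerSeries ℂ_[p], CycLineInterpolation ι K fE α Car G ∧
      ∃ (P₁ P₂ : (W.baseChange K).toAffine.Point) (q : ℚ) (σ₀ : ℤˣ), q ≠ 0 ∧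
        ArchRatioClause W K fE Car P₁ P₂ q ∧ PAdicRatioClause W K α G DhK P₁ P₂ q σ₀ :=
  h

end Ratio

/-! ### §5 The constants are harmless: `u ≠ 0`, `p* ≠ 0`, `Z°_p(𝟙_K) ≠ 0` -/

section Constants

variable (p : ℕ) [Fact p.Prime]

/-- `u = ((1 − p⁻²)(1 − p⁻¹)²)⁻¹ ≠ 0`. [cite: Disegni2017, Theorem A (Z°_v; arXiv v3 PDF p. 7)] -/
theorem splitLocalConstant_ne_zero : splitLocalConstant p ≠ 0 := by
  have hp : (2 : ℚ) ≤ p := by exact_mod_cast (Fact.out : p.Prime).two_le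
  have h1 : (1 : ℚ) - ((p : ℚ) ^ 2)⁻¹ ≠ 0 := by
    have : ((p : ℚ) ^ 2)⁻¹ < 1 := by
      rw [inv_lt_one_iff₀]; right; nlinarith
    linarith
  have h2 : (1 : ℚ) - (p : ℚ)⁻¹ ≠ 0 := by
    have : ((p : ℚ))⁻¹ < 1 := by
      rw [inv_lt_one_iff₀]; right; linarith
    linarith
  unfold splitLocalConstant
  exact inv_ne_zero (mul_ne_zero h1 (pow_ne_zero _ h2))

/-- `p* ≠ 0` (so `Z°_p(𝟙_K) ≠ 0`, Def. 1.3.3). [cite: Disegni2017, Def. 1.3.3 (arXiv v3 PDF p. 9)] -/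
theorem pStar_ne_zero : pStar p ≠ 0 := by
  unfold pStar
  exact mul_ne_zero (pow_ne_zero _ (by norm_num)) (by exact_mod_cast (Fact.out : p.Prime).ne_zero)

/-- **`Z°_p(𝟙_K) ≠ 0` for `α ≠ 0`** — the trivial character of `K` is not exceptional for `σ_{E,p}` with
a ramified unit character (Def. 1.3.3: `Z_w(𝟙_w) = α⁻¹τ(ε) ≠ 0`).
[cite: Disegni2017, Def. 1.3.3 (arXiv v3 PDF p. 9) with Lemma A.1.1 (PDF p. 70)] -/
theorem zCircOne_ne_zero {α : ℚ_[p]} (hα : α ≠ 0) : zCircOne p α ≠ 0 := by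
  unfold zCircOne
  refine mul_ne_zero (mul_ne_zero ?_ ?_) (inv_ne_zero (pow_ne_zero _ hα))
  · exact_mod_cast splitLocalConstant_ne_zero p
  · exact_mod_cast pStar_ne_zero p

end Constants

end Literature.NumberTheory.EllipticCurves.Disegni2017

end
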